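import Literature.Probability.LatticeModels.DobrushinShlosmanInfiniteVolume
import HarnessLib

/-!
# The Dobrushin–Shlosman window comparison for the CONDITIONAL specification: covariance decay of the
# finite-volume kernels `γ_Λ(· | η)`, for every volume and every boundary condition (interior form)

Topic `Literature/Probability/LatticeModels`; theorems only (no definitions, no named facts). Continues
`DobrushinShlosmanInfiniteVolume.lean`, whose two-functional engine `abs_sub_le_of_window` is run there with
`E₁ = μ` a Gibbs measure and `E₂` its tilt. Here the same engine is run with `E₁ = γ_Λ(· | η)` — a KERNEL of the
specification, i.e. a Gibbs measure of Föllmer's conditional specification `π^{Λ,η}` (1988, Ch. I, (2.10)) — and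
`E₂` its tilt by the shifted density `g̃`: both are invariant under the window kernels `γ_{win c}` of the centres
`c ∈ Λ` with `nbhd c ⊆ Λ` (CONSISTENCY of the specification instead of the DLR equations) that avoid the support
of `g` (properness). The result,

* `abs_covariance_kernel_le_of_window` — for EVERY finite `Λ`, EVERY boundary condition `η`, bounded measurable
  `f` (support `Δf ⊆ Λ`), `g` (support `Δg`) with site-Lipschitz vectors, and a profile `ℓ` with: every window
  through a site of positive profile has its centre and locality set inside `Λ` and avoids `Δg`, `ℓ` drops by
  at most one along the support of the array, `ℓ ≥ L₀` on `Δf`: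
  `|cov_{γ_Λ(·|η)}(f, g)| ≤ 4 R² e^{−κ₁ L₀} (Σ δ_f)(Σ δ_g)`, `κ₁ = (1−γ₀)²/(2(2γ₀N⋆+1))`,

is the Kantorovich (Lipschitz-observable) form of Dobrushin–Shlosman's finite-volume mixing for window (block)
conditions, in the INTERIOR form: the profile — hence the decay — saturates at the distance of `Δf` to the sites of
`Λ` whose windows leave `Λ` (near the boundary only single windows inside `Λ` are usable; no claim is made about
windows cut by the boundary). The single-site analogue with full uniformity is `DobrushinComparisonBoundary.lean` /
the venture file `KernelClustering.lean`.

References: R. L. Dobrushin, S. B. Shlosman, in *Statistical Physics and Dynamical Systems* (1985), Thm. 1, §2;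
J. Stat. Phys. 46 (1987) 983–1014 (finite-volume mixing conditions); H. Föllmer, LNM 1362 (1988) Ch. I (2.10),
Thm. (2.13); H. Künsch, CMP 84 (1982); H.-O. Georgii (2011) §8.2; tree files `DobrushinShlosmanInfiniteVolume.lean`
(followed line by line), `DobrushinShlosmanStates.lean`.
-/

noncomputable section

open MeasureTheory ProbabilityTheory Finset Function
open Literature.Probability.LatticeModels.DobrushinMetric (IsLipBound integrable_of_abs_le'
  abs_sub_le_mul_sum_of_dependsOn)

namespace Literature.Probability.LatticeModels.DobrushinShlosman

variable {V S : Type*} [MeasurableSpace S]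

/-- **Covariance decay of the finite-volume kernels under the Dobrushin–Shlosman window condition, arbitrary
index set, interior form** (Föllmer 1988 Ch. I Thm. (2.13) for the conditional specification (2.10); Künsch 1982;
Georgii 2011 §8.2; Dobrushin–Shlosman 1985/1987). Window data as in `abs_covariance_le_of_window` (specification `γ`,
site weight `0 ≤ r ≤ R`, windows `win c ∋ c` with locality sets `nbhd c ⊇ win c`, array `K ≥ 0` supported in
`nbhd c`, sitewise contraction (H1) `hcontract`, locality `hloc`, per-window received sum `≤ γ₀ < 1`, `≤ N⋆` windows
per site). For EVERY finite `Λ`, EVERY boundary condition `η`, bounded measurable `f, g` reading `Δf ⊆ Λ`, `Δg` with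
site-Lipschitz vectors `δf, δg`, and a profile `ℓ` such that every window through a site of positive profile has
`c ∈ Λ`, `nbhd c ⊆ Λ` and avoids `Δg`, `ℓ` drops by at most one along the support of `K`, and `ℓ ≥ L₀` on `Δf`:
`|cov_{γ_Λ(·|η)}(f, g)| ≤ 4 R² e^{−(1−γ₀)² L₀/(2(2γ₀N⋆+1))} (Σ δf)(Σ δg)` — the tilt trick with `E₁ = γ_Λ(·|η)` and
`E₂ = γ_Λ(g̃ ·|η)/γ_Λ(g̃|η)`, both invariant under the usable window kernels by CONSISTENCY and properness.
[cite: Follmer1988, Ch. I Theorem (2.13)] [cite: DobrushinShlosman1985, Theorem 1] -/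
theorem abs_covariance_kernel_le_of_window [DecidableEq V] {γ : Specification V S} (hγ : IsSpecification γ)
    {r : S → S → ℝ} {R : ℝ} (hr0 : ∀ a b, 0 ≤ r a b) (hrR : ∀ a b, r a b ≤ R) (hR : 0 ≤ R)
    {win nbhd : V → Finset V} {K : V → V → V → ℝ} (hK0 : ∀ c y x, 0 ≤ K c y x)
    (hself : ∀ c, c ∈ win c) (hwin : ∀ c, win c ⊆ nbhd c)
    (hKsupp : ∀ c y x, K c y x ≠ 0 → y ∈ nbhd c)
    (hcontract : ∀ (c y : V), y ∉ win c → ∀ (ω η : V → S), (∀ v, v ≠ y → ω v = η v) →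
      ∀ (f : (V → S) → ℝ) (δ : V → ℝ), Measurable f → (∃ B, ∀ σ, |f σ| ≤ B) →
        DependsOn f (win c : Set V) → (∀ x, 0 ≤ δ x) →
        (∀ (x : V) (σ τ : V → S), (∀ v, v ≠ x → σ v = τ v) → |f σ - f τ| ≤ δ x * r (σ x) (τ x)) →
          |∫ σ, f σ ∂(γ (win c) ω) - ∫ σ, f σ ∂(γ (win c) η)| ≤
            (∑ x ∈ win c, K c y x * δ x) * r (ω y) (η y))
    (hloc : ∀ (c : V) (ζ ζ' : V → S), (∀ v ∈ nbhd c, ζ v = ζ' v) →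
      ∀ (f : (V → S) → ℝ), Measurable f → (∃ B, ∀ σ, |f σ| ≤ B) → DependsOn f (win c : Set V) →
        ∫ σ, f σ ∂(γ (win c) ζ) = ∫ σ, f σ ∂(γ (win c) ζ'))
    {γ₀ : ℝ} (hγ₀ : 0 ≤ γ₀) (hγ₁ : γ₀ < 1)
    (hsum : ∀ c, ∀ x ∈ win c, ∑ y ∈ nbhd c, K c y x ≤ γ₀)
    {Nstar : ℕ} (hN : ∀ (x : V) (G : Finset V), (G.filter fun c => x ∈ win c).card ≤ Nstar)
    (Λ : Finset V) (η : V → S) {f g : (V → S) → ℝ} (hfm : Measurable f)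
    (hgm : Measurable g) {Bf Bg : ℝ} (hBf : ∀ σ, |f σ| ≤ Bf) (hBg : ∀ σ, |g σ| ≤ Bg)
    {Δf Δg : Finset V} (hfdep : DependsOn f (Δf : Set V)) (hgdep : DependsOn g (Δg : Set V))
    {δf δg : V → ℝ} (hδf : IsLipBound r f δf) (hδg : IsLipBound r g δg)
    (hΔf : Δf ⊆ Λ) (ℓ : V → ℕ) (L₀ : ℕ)
    (hU : ∀ x, ℓ x ≠ 0 → ∀ c, x ∈ win c → c ∈ Λ ∧ nbhd c ⊆ Λ ∧ ∀ z ∈ win c, z ∉ Δg)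
    (hℓ : ∀ c x y, x ∈ win c → K c y x ≠ 0 → ℓ x ≤ ℓ y + 1) (hL : ∀ x ∈ Δf, L₀ ≤ ℓ x) :
    |cov[f, g; γ Λ η]| ≤ 4 * R ^ 2 * Real.exp (-((1 - γ₀) ^ 2 / (2 * (2 * γ₀ * Nstar + 1)) * L₀)) *
      (∑ x ∈ Δf, δf x) * ∑ y ∈ Δg, δg y := by
  -- adapted from `DobrushinShlosman.abs_covariance_le_of_window` (Gibbs measure ↦ kernel; DLR ↦ consistency)
  classical
  haveI := hγ.isProbability Λ η
  obtain ⟨τ₀, -⟩ := nonempty_of_measure_ne_zero (μ := γ Λ η) (s := Set.univ) (by simp)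
  set μ : Measure (V → S) := γ Λ η with hμdef
  set κ₁ : ℝ := (1 - γ₀) ^ 2 / (2 * (2 * γ₀ * Nstar + 1)) with hκ₁
  -- the shifted density `g̃ ∈ [0, 2 S_g]`
  set Sg : ℝ := R * ∑ y ∈ Δg, δg y with hSg
  have hSg0 : 0 ≤ Sg := mul_nonneg hR (Finset.sum_nonneg fun y _ => hδg.nonneg y)
  have hosc : ∀ σ, |g σ - g τ₀| ≤ Sg := fun σ => abs_sub_le_mul_sum_of_dependsOn hrR hgdep hδg σ τ₀
  set gt : (V → S) → ℝ := fun σ => g σ + (Sg - g τ₀) with hgt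
  have hgt0 : ∀ σ, 0 ≤ gt σ := fun σ => by
    have := (abs_le.1 (hosc σ)).1; simp only [hgt]; linarith
  have hgtB : ∀ σ, gt σ ≤ 2 * Sg := fun σ => by
    have := (abs_le.1 (hosc σ)).2; simp only [hgt]; linarith
  have hgtm : Measurable gt := hgm.add_const _
  have hgtdep : DependsOn gt (Δg : Set V) := fun σ τ h => by
    simp only [hgt]; rw [hgdep h]
  have hgi : Integrable g μ := integrable_of_abs_le' hgm hBg
  have hfi : Integrable f μ := integrable_of_abs_le' hfm hBf
  have hgtabs : ∀ σ, |gt σ| ≤ 2 * Sg := fun σ => by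
    rw [abs_of_nonneg (hgt0 σ)]; exact hgtB σ
  have hgti : Integrable gt μ := integrable_of_abs_le' hgtm hgtabs
  -- the right-hand side is nonnegative
  have hRHS : 0 ≤ 4 * R ^ 2 * Real.exp (-(κ₁ * L₀)) * (∑ x ∈ Δf, δf x) * ∑ y ∈ Δg, δg y := by
    have := Finset.sum_nonneg fun x (_ : x ∈ Δf) => hδf.nonneg x
    have := Finset.sum_nonneg fun y (_ : y ∈ Δg) => hδg.nonneg y
    positivity
  -- `cov(f, g) = cov(f, g̃) = μ(f g̃) - μ(f) μ(g̃)`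
  have hcov : cov[f, g; μ] = ∫ σ, f σ * gt σ ∂μ - (∫ σ, f σ ∂μ) * ∫ σ, gt σ ∂μ := by
    have h1 : cov[f, g; μ] = cov[f, gt; μ] := by
      rw [hgt, covariance_add_const_right hgi]
    rw [h1, covariance_eq_sub]
    · rfl
    · exact memLp_of_bounded (a := -Bf) (b := Bf)
        (ae_of_all _ fun σ => abs_le.1 (hBf σ)) hfm.aestronglyMeasurable 2
    · exact memLp_of_bounded (a := -(2 * Sg)) (b := 2 * Sg)
        (ae_of_all _ fun σ => abs_le.1 (hgtabs σ)) hgtm.aestronglyMeasurable 2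
  by_cases hz : ∫ σ, gt σ ∂μ = 0
  · -- degenerate case: `g̃ = 0` a.e., so the covariance vanishes
    have hae : gt =ᵐ[μ] 0 := (integral_eq_zero_iff_of_nonneg (fun σ => hgt0 σ) hgti).1 hz
    have hfg : ∫ σ, f σ * gt σ ∂μ = 0 := by
      rw [← integral_zero (α := V → S) (μ := μ) (G := ℝ)]
      refine integral_congr_ae ?_
      filter_upwards [hae] with σ hσ
      simp [hσ]
    rw [hcov, hfg, hz, mul_zero, sub_zero, abs_zero]
    exact hRHS
  have hpos : 0 < ∫ σ, gt σ ∂μ := lt_of_le_of_ne (integral_nonneg hgt0) (Ne.symm hz)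
  -- the two functionals: the kernel and its tilt by `g̃`; usable = windows inside `Λ` avoiding `Δg`
  have hgfi : ∀ {F : (V → S) → ℝ}, Measurable F → ∀ {B : ℝ}, (∀ σ, |F σ| ≤ B) →
      Integrable (fun σ => gt σ * F σ) μ := fun hFm B hB =>
    hgti.mul_bdd hFm.aestronglyMeasurable (ae_of_all _ fun σ => by rw [Real.norm_eq_abs]; exact hB σ)
  have h₁le : ∀ ⦃F : (V → S) → ℝ⦄ ⦃M : ℝ⦄, Measurable F → (∃ B, ∀ σ, |F σ| ≤ B) →
      DependsOn F (Λ : Set V) → (∀ σ, F σ ≤ M) → ∫ σ, F σ ∂μ ≤ M := by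
    rintro F M hFm ⟨B, hB⟩ - hM
    calc ∫ σ, F σ ∂μ ≤ ∫ _σ, M ∂μ := integral_mono (integrable_of_abs_le' hFm hB) (integrable_const M) hM
      _ = M := by simp
  have h₁ge : ∀ ⦃F : (V → S) → ℝ⦄ ⦃M : ℝ⦄, Measurable F → (∃ B, ∀ σ, |F σ| ≤ B) →
      DependsOn F (Λ : Set V) → (∀ σ, M ≤ F σ) → M ≤ ∫ σ, F σ ∂μ := by
    rintro F M hFm ⟨B, hB⟩ - hM
    calc M = ∫ _σ, M ∂μ := by simp
      _ ≤ ∫ σ, F σ ∂μ := integral_mono (integrable_const M) (integrable_of_abs_le' hFm hB) hM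
  -- CONSISTENCY: the kernel `γ_Λ(·|η)` is invariant under `γ_{win c}` for `win c ⊆ Λ`
  have h₁T : ∀ c, c ∈ Λ → nbhd c ⊆ Λ → (∀ z ∈ win c, z ∉ Δg) → ∀ ⦃F : (V → S) → ℝ⦄, Measurable F →
      (∃ B, ∀ σ, |F σ| ≤ B) → DependsOn F (Λ : Set V) →
        ∫ σ, (fun σ => ∫ τ, F τ ∂(γ (win c) σ)) σ ∂μ = ∫ σ, F σ ∂μ := by
    rintro c - hnb - F hFm ⟨B, hB⟩ -
    exact hγ.integral_integral_consistent ((hwin c).trans hnb) η (integrable_of_abs_le' hFm hB)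
  have h₂le : ∀ ⦃F : (V → S) → ℝ⦄ ⦃M : ℝ⦄, Measurable F → (∃ B, ∀ σ, |F σ| ≤ B) →
      DependsOn F (Λ : Set V) → (∀ σ, F σ ≤ M) → (∫ σ, gt σ * F σ ∂μ) / ∫ σ, gt σ ∂μ ≤ M := by
    rintro F M hFm ⟨B, hB⟩ - hM
    rw [div_le_iff₀ hpos]
    calc ∫ σ, gt σ * F σ ∂μ ≤ ∫ σ, gt σ * M ∂μ :=
          integral_mono (hgfi hFm hB) (hgti.mul_const M) fun σ => mul_le_mul_of_nonneg_left (hM σ) (hgt0 σ)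
      _ = M * ∫ σ, gt σ ∂μ := by rw [integral_mul_const, mul_comm]
  have h₂ge : ∀ ⦃F : (V → S) → ℝ⦄ ⦃M : ℝ⦄, Measurable F → (∃ B, ∀ σ, |F σ| ≤ B) →
      DependsOn F (Λ : Set V) → (∀ σ, M ≤ F σ) → M ≤ (∫ σ, gt σ * F σ ∂μ) / ∫ σ, gt σ ∂μ := by
    rintro F M hFm ⟨B, hB⟩ - hM
    rw [le_div_iff₀ hpos]
    calc M * ∫ σ, gt σ ∂μ = ∫ σ, gt σ * M ∂μ := by rw [integral_mul_const, mul_comm]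
      _ ≤ ∫ σ, gt σ * F σ ∂μ :=
          integral_mono (hgti.mul_const M) (hgfi hFm hB) fun σ => mul_le_mul_of_nonneg_left (hM σ) (hgt0 σ)
  have h₂T : ∀ c, c ∈ Λ → nbhd c ⊆ Λ → (∀ z ∈ win c, z ∉ Δg) → ∀ ⦃F : (V → S) → ℝ⦄, Measurable F →
      (∃ B, ∀ σ, |F σ| ≤ B) → DependsOn F (Λ : Set V) →
        (∫ σ, gt σ * (fun σ => ∫ τ, F τ ∂(γ (win c) σ)) σ ∂μ) / ∫ σ, gt σ ∂μ =
          (∫ σ, gt σ * F σ ∂μ) / ∫ σ, gt σ ∂μ := by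
    rintro c - hnb hc F hFm ⟨B, hB⟩ -
    congr 1
    have hmul : ∀ ζ, gt ζ * (∫ τ, F τ ∂(γ (win c) ζ)) = ∫ τ, gt τ * F τ ∂(γ (win c) ζ) := fun ζ =>
      mul_windowAvg_eq_of_dependsOn hγ (cell := id) (Λ := win c) (W := win c) (fun v => Iff.rfl)
        (g := gt) (Δg := Δg) hgtdep hc F ζ
    simp_rw [hmul]
    exact hγ.integral_integral_consistent ((hwin c).trans hnb) η (hgfi hFm hB)
  -- the comparison theorem for `f` with its Lipschitz vector cut down to `Δf`
  have hfdepΛ : DependsOn f (Λ : Set V) :=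
    hfdep.mono fun v hv => Finset.mem_coe.2 (hΔf (Finset.mem_coe.1 hv))
  have hδL : ∀ x, ℓ x < L₀ → (fun x => if x ∈ Δf then δf x else 0) x = 0 := fun x hx => by
    dsimp only
    split_ifs with hxΔ
    · exact absurd (hL x hxΔ) (not_le.2 hx)
    · rfl
  have key := abs_sub_le_of_window hγ hr0 hrR hR hK0 hself hwin hKsupp hcontract hloc hγ₀ hγ₁ hsum hN
    Λ τ₀ (fun c => ∀ z ∈ win c, z ∉ Δg) (E₁ := fun F => ∫ σ, F σ ∂μ)
    (E₂ := fun F => (∫ σ, gt σ * F σ ∂μ) / ∫ σ, gt σ ∂μ) h₁le h₁ge h₁T h₂le h₂ge h₂T ℓ L₀ hU hℓ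
    hfm hBf hfdepΛ (hδf.restrict hfdep) hδL
  have hs : ∑ x ∈ Λ, (if x ∈ Δf then δf x else 0) = ∑ x ∈ Δf, δf x := by
    rw [Finset.sum_ite_mem, Finset.inter_eq_right.2 hΔf]
  rw [hs] at key
  change |∫ σ, f σ ∂μ - (∫ σ, gt σ * f σ ∂μ) / ∫ σ, gt σ ∂μ| ≤
    2 * R * Real.exp (-(κ₁ * L₀)) * ∑ x ∈ Δf, δf x at key
  -- `cov = μ(g̃) · (μ_{g̃}(f) - μ(f))`
  have hfgt : ∫ σ, f σ * gt σ ∂μ = ∫ σ, gt σ * f σ ∂μ :=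
    integral_congr_ae (ae_of_all _ fun σ => mul_comm _ _)
  have hident : cov[f, g; μ] =
      (∫ σ, gt σ ∂μ) * ((∫ σ, gt σ * f σ ∂μ) / ∫ σ, gt σ ∂μ - ∫ σ, f σ ∂μ) := by
    rw [hcov, hfgt, mul_sub, mul_div_cancel₀ _ hz]
    ring
  rw [hident, abs_mul, abs_of_pos hpos, abs_sub_comm]
  have hgtint : ∫ σ, gt σ ∂μ ≤ 2 * Sg := by
    calc ∫ σ, gt σ ∂μ ≤ ∫ _σ, 2 * Sg ∂μ := integral_mono hgti (integrable_const _) hgtB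
      _ = 2 * Sg := by simp
  have hexp : 0 ≤ 2 * R * Real.exp (-(κ₁ * L₀)) * ∑ x ∈ Δf, δf x := by
    have := Finset.sum_nonneg fun x (_ : x ∈ Δf) => hδf.nonneg x
    positivity
  calc (∫ σ, gt σ ∂μ) * |∫ σ, f σ ∂μ - (∫ σ, gt σ * f σ ∂μ) / ∫ σ, gt σ ∂μ|
      ≤ (2 * Sg) * (2 * R * Real.exp (-(κ₁ * L₀)) * ∑ x ∈ Δf, δf x) :=
        mul_le_mul hgtint key (abs_nonneg _) (by positivity)
    _ = 4 * R ^ 2 * Real.exp (-(κ₁ * L₀)) * (∑ x ∈ Δf, δf x) * ∑ y ∈ Δg, δg y := by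
        rw [hSg]; ring

end Literature.Probability.LatticeModels.DobrushinShlosman

end
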